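import Summits.BirchSwinnertonDyer.BirchSwinnertonDyer.Theses.SignedBaseChange
import Summits.BirchSwinnertonDyer.Rank1Residual.Supersingular.KobayashiMainConjectureX7
import Summits.BirchSwinnertonDyer.Rank1Residual.Supersingular.KobayashiSqueezeReal
import HarnessLib

/-!
# K2R `SignedDescentFromGreenbergFrames` (route SignedBaseChange, crux stmt-BirchSwinnertonDyer-20087) REDUCED to
# its Eisenstein half: signed LOWER descent + the period-ratio unit ⇒ K2R (helpers `--supports`, seat `bsd-wall-sbc-p2`)

K2R concludes Kobayashi's main conjecture `KobayashiMainConjecture W p ε` in the NÉRON normalisation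
(`Char X^ε = (g)`, `g = ϖ · L^ε`, `ϖ · Ω_E = Ω⁺_f`). Its binders supply the Kato half (Kobayashi Thm. 4.1, integral
under `Surj`) and torsion (Thm. 1.2); what the Greenberg package must deliver is the EISENSTEIN half. The p-power
bookkeeping between the two halves is NOT free: lower (`g = ϖ L^ε h`) + Kato (`L^ε ∈ (g)`) give `h·k = ϖ⁻¹ ∈ ℤ_p`
and `(g) = (ϖ p^{ord_p h} L^ε)`, so the conjecture's `(g) = (ϖ L^ε)` needs `ord_p ϖ = 0` — in the tree the NAMED
FACT `realPeriodRat_eq_unit_mul_plusPeriod` (a conjunct of the route's `PublishedSignedInputs`, not a binder of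
K2R). This file makes that explicit:

* §5 `kobayashiMainConjecture_of_lowerDivisibility_of_periodUnit` — the tree squeeze
  (`Supersingular.kobayashiMainConjecture_of_lowerDivisibility_of_thm41`) with the period input displayed PER PAIR;
* §6 `signedDescentFromGreenbergFrames_of_periodUnit_of_lowerDescent` — K2R ⇐ (U) period unit at X7 pairs `p ≥ 5`
  ∧ (D) the signed lower descent (the crux skeleton's stub `stub_signedLowerDescent`, verbatim as a binder);
  `signedDescentFromGreenbergFrames_of_periodFact_of_lowerDescent` — the same with (U) discharged from the named
  fact. CONDITIONAL theorems; they close nothing by themselves (the gate records `proof.conditional`).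

* §7 (appended after the route's F-repair): the same reduction for K2R′ `SignedDescentFromCommonFrame`
  (stmt-BirchSwinnertonDyer-20417, antecedent GSF).
* §8 the PRODUCT SQUEEZE (generic domain algebra): the last step of the signed lower descent for the twist pair
  (four Kato bounds + one product divisibility ⇒ four equalities).

References: [Kobayashi2003] Conjecture (p. 2), Thm. 1.2, Thm. 4.1; [GreenbergVatsal2000] §3 Rem. 3.4.
-/

set_option autoImplicit false

noncomputable section

open scoped Classical MatrixGroups ModularForm

open CongruenceSubgroup WeierstrassCurve Literature.NumberTheory.EllipticCurves
  Literature.NumberTheory.EllipticCurves.ModularForms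
  Literature.NumberTheory.EllipticCurves.Rank1Residual

namespace Summit.BirchSwinnertonDyer.BirchSwinnertonDyer.Theorems.SignedBaseChangeK2RSqueeze

/-! ## §5. The squeeze at a pair with the period ratio a `p`-adic unit: Eisenstein half + Kato ⇒ KMC -/

open Summit.BirchSwinnertonDyer.Rank1Residual.Supersingular Kobayashi2003 ZpExtension in
/-- **Kobayashi's main conjecture for `(E, p, ε)` from its EISENSTEIN HALF, Kobayashi Thm. 4.1 / 1.2, and the
period-ratio unit AT THE PAIR.** As the tree's `Supersingular.kobayashiMainConjecture_of_lowerDivisibility_of_thm41`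
(`Partition/MainConjecturesSignedLowerDivisibility.lean`) but with the period input displayed PER PAIR
(`hunit : ord_p ϖ = 0` for every newform `f` of `W` and every `ϖ` with `ϖ · Ω_E = Ω⁺_f`) instead of the two named
facts `realPeriodRat_eq_unit_mul_plusPeriod(_three)`: `p` odd good with `a_p = 0`, `ρ̄_{E,p}` onto; then
`KobayashiLowerDivisibility W p ε` (`Char X^ε = (g)`, `ι g = ϖ · ι(L^ε h)`) and Thm. 4.1 (`g ∣ L^ε`, integral under
`p`-adic surjectivity, automatic from `Surj` at a good odd `p`) give `(g) = (L^ε) = (C(u) L^ε)`, `u = ϖ ∈ ℤ_p^×`.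
This is the p-power bookkeeping that K2R's conclusion (NÉRON normalisation) requires and that K2R's binders
(thm41, thm12, F) do not supply by themselves. [cite: Kobayashi2003, Conjecture (p. 2), Thm. 1.2, Thm. 4.1 (p. 8)]
[cite: GreenbergVatsal2000, §3 Remark 3.4] -/
theorem kobayashiMainConjecture_of_lowerDivisibility_of_periodUnit
    (h12 : thm12_signedSelmerDual_finite_torsion) (h41 : thm41_signedCharIdeal_divisibility)
    (W : WeierstrassCurve ℚ) [W.IsElliptic] [W.IsGloballyMinimal] (p : ℕ) [Fact p.Prime]
    (hp : p ≠ 2) (hgood : W.HasGoodReductionAtPrime p) (hap : W.frobeniusTrace p = 0) (hs : Surj W p)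
    (hunit : ∀ {N : ℕ} [NeZero N] (f : CuspForm (Gamma0 N) 2), IsNewformOf W f →
      ∀ ϖ : ℚ, (ϖ : ℝ) * W.realPeriodRat = plusPeriod f → padicValRat p ϖ = 0)
    (ε : ℤˣ) (hlow : KobayashiLowerDivisibility W p ε) : KobayashiMainConjecture W p ε := by
  intro κ γ hκ hγ hγ' _ f hf ϖ hϖ Lplus Lminus hPP D
  -- Thm. 1.2: `X^ε` finitely generated and torsion
  haveI hfin : Module.Finite (IwasawaAlgebra p) D.X := h12.moduleFinite hp hgood hap hκ hγ D
  have hX : Module.IsTorsion (IwasawaAlgebra p) D.X := h12.isTorsion hp hgood hap hκ hγ D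
  refine ⟨hX, ?_⟩
  -- the Eisenstein half: `Char(X^ε) = (g)`, `ι g = ϖ · ι(L^ε · h)`
  obtain ⟨g, h, hg, hιg⟩ := hlow κ γ hκ hγ hγ' f hf ϖ hϖ Lplus Lminus hPP D
  set L := kobayashiL ε Lplus Lminus with hL_def
  have hL : IsSignedPAdicLFunction f p ε L := hPP.isSignedPAdicLFunction_kobayashiL ε
  -- the Kato half (Kobayashi Thm. 4.1, integral under `p`-adic surjectivity): `g ∣ L^ε`
  have hsurj : ∀ m : ℕ, W.HasSurjectiveModNGaloisRep (p ^ m : ℕ) :=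
    surjective_pow_of_surj_of_good W p Wuthrich2014.lemma20_surjective_threeAdic_of_semistable_holds
      hp hgood hs
  have hU : g ∣ L := h41.dvd_of_charIdeal_eq_span hp hgood hap hf hκ hγ hγ' hL D hX hsurj hg
  -- the period ratio `ϖ` is a `p`-adic unit (hypothesis `hunit` at the pair)
  have hvϖ : padicValRat p ϖ = 0 := hunit f hf ϖ hϖ
  have hϖ0 : ϖ ≠ 0 := by
    intro hz
    rw [hz, Rat.cast_zero, zero_mul] at hϖ
    exact (IsNewform0.plusPeriod_pos_holds hf.1 hf.coeffField_eq_bot).ne' hϖ.symm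
  obtain ⟨u, hu⟩ := exists_units_coe_eq_ratCast hϖ0 hvϖ
  obtain ⟨hspan', hι⟩ := span_C_units_mul_eq u L
  -- the Eisenstein half read in `Λ`: `g = C(u) · L^ε · h`, hence `L^ε ∣ g`
  have hgL : g = PowerSeries.C (u : ℤ_[p]) * L * h := by
    apply iwasawaToPowerSeries_injective p
    rw [hιg, map_mul (iwasawaToPowerSeries p) (PowerSeries.C (u : ℤ_[p]) * L) h, hι, hu, map_mul,
      mul_assoc]
  have hLg : L ∣ g := ⟨PowerSeries.C (u : ℤ_[p]) * h, by rw [hgL]; ring⟩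
  -- `(g) = (L^ε) = (C(u) · L^ε)` and `ι(C(u) · L^ε) = ϖ · ι L^ε`
  refine ⟨PowerSeries.C (u : ℤ_[p]) * L, ?_, ?_⟩
  · rw [hg, hspan']
    exact le_antisymm (Ideal.span_singleton_le_span_singleton.mpr hLg)
      (Ideal.span_singleton_le_span_singleton.mpr hU)
  · rw [hι, hu]

/-! ## §6. The reduction of K2R: signed LOWER descent + the period unit at X7 pairs ⇒ K2R -/

open Summit.BirchSwinnertonDyer.BirchSwinnertonDyer.Theses.SignedBaseChange
  Summit.BirchSwinnertonDyer.Rank1Residual.Supersingular Kobayashi2003 in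
/-- **K2R reduced to its Eisenstein half.** `SignedDescentFromGreenbergFrames` follows from TWO displayed inputs:
(U) the period-ratio unit at every X7 pair with `p ≥ 5` and surjective `ρ̄` (`ord_p(Ω⁺_f/Ω_E) = 0`; in the tree
this is the NAMED FACT `realPeriodRat_eq_unit_mul_plusPeriod`, see
`signedDescentFromGreenbergFrames_of_periodFact_of_lowerDescent`), and (D) the SIGNED LOWER DESCENT: K2R's hypotheses
(Kobayashi Thm. 1.2, F, the twist-pair Greenberg package of K1) imply the EISENSTEIN HALF
`KobayashiLowerDivisibility W p ε` of Kobayashi's main conjecture for both signs — the registered stub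
`stub_signedLowerDescent` of the crux skeleton, VERBATIM as the binder `hdesc`. The Kato half is Kobayashi Thm. 4.1
(K2R's own binder `thm41`), and the squeeze is `kobayashiMainConjecture_of_lowerDivisibility_of_periodUnit`.
CONDITIONAL on (U) and (D); closes nothing by itself. [cite: Kobayashi2003, Conjecture (p. 2), Thm. 1.2, Thm. 4.1 (p. 8)] -/
theorem signedDescentFromGreenbergFrames_of_periodUnit_of_lowerDescent
    (hunit : ∀ (W : WeierstrassCurve ℚ) [W.IsElliptic] [W.IsGloballyMinimal] (p : ℕ) [Fact p.Prime],
      5 ≤ p → ClassX7 W p → Surj W p →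
      ∀ {N : ℕ} [NeZero N] (f : CuspForm (Gamma0 N) 2), IsNewformOf W f →
      ∀ ϖ : ℚ, (ϖ : ℝ) * W.realPeriodRat = plusPeriod f → padicValRat p ϖ = 0)
    (hdesc : thm12_signedSelmerDual_finite_torsion → GreenbergFramesAtSupersingular →
      ∀ (W : WeierstrassCurve ℚ) [W.IsElliptic] [W.IsGloballyMinimal] (p : ℕ) [Fact p.Prime], 5 ≤ p →
      ClassX7 W p → Surj W p → (∃ (K : Type) (_ : Field K) (_ : NumberField K) (ι : PadicAlgCl p ≃+* ℂ) (v vbar : IsDedekindDomain.HeightOneSpectrum (NumberField.RingOfIntegers K)) (κ₁ κ₂ : Literature.NumberTheory.EllipticCurves.ZpExtension K p) (γ₁ γ₂ : Field.absoluteGaloisGroup K) (_ : Fact (Literature.NumberTheory.EllipticCurves.ZpExtension.IsTopGeneratorPair κ₁ κ₂ γ₁ γ₂)) (_ : NeZero (NumberField.discr K).natAbs) (N : ℕ) (_ : NeZero N) (f : CuspForm (CongruenceSubgroup.Gamma0 N) 2) (d : ℤ) (W' : WeierstrassCurve ℚ) (_ : W'.IsElliptic) (_ : W'.IsGloballyMinimal)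 (C : WeierstrassCurve.VariableChange ℚ) (N' : ℕ) (_ : NeZero N') (f' : CuspForm (CongruenceSubgroup.Gamma0 N') 2), Literature.NumberTheory.EllipticCurves.ModularForms.IsNewformOf W f ∧ (N : ℤ) = W.conductorNorm ℤ ∧ Literature.NumberTheory.EllipticCurves.ModularForms.IsNewformOf W' f' ∧ (N' : ℤ) = W'.conductorNorm ℤ ∧ Squarefree d ∧ 1 < d ∧ (∀ q : ℕ, q.Prime → Literature.NumberTheory.EllipticCurves.BurungaleSkinnerTianWan2024.RamifiedInQuadratic d q → q ≠ p ∧ ¬ q ∣ N ∧ ¬ (q : ℤ) ∣ NumberField.discr K) ∧ C • W' = W.quadraticTwist (d : ℚ) ∧ Literature.NumberTheory.EllipticCurves.IsImaginaryQuadratic K ∧ ((Ideal.span {(p : ℤ)}).primesOver (NumberField.RingOfIntegers K)).ncard = 2 ∧ ((p : ℕ) : NumberField.RingOfIntegers K) ∈ v.asIdeal ∧ ((p : ℕ) : NumberField.RingOfIntegers K) ∈ vbar.asIdeal ∧ vbar ≠ v ∧ (∀ (w : NumberField.InfinitePlace K) (k : NumberField.RingOfIntegers K), k ∈ v.asIdeal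 ↔ ‖ι.symm (w.embedding (k : K))‖ < 1) ∧ IsCoprime (N : ℤ) (NumberField.discr K) ∧ (∀ ρ : Literature.NumberTheory.GaloisRepresentations.ModPGaloisRep K (ZMod p) 2, (W.baseChange K).IsTorsionGaloisRep p ρ → Literature.NumberTheory.GaloisRepresentations.FramedRep.IsAbsolutelyIrreducible ρ) ∧ κ₁.IsCyclotomic ∧ κ₂.IsAnticyclotomic ∧ ∀ (Ω δ : ℂ) (Ωp : (Literature.NumberTheory.EllipticCurves.unrIntegers p)ˣ) (LK G G' : PowerSeries (PowerSeries (PadicComplexInt p))), Ω ≠ 0 → (δ ^ 2 = (NumberField.discr K : ℂ) ∨ δ ^ 2 = -(NumberField.discr K : ℂ)) → Literature.NumberTheory.EllipticCurves.IsKatzMeasure₂ ι v vbar ∅ κ₁ κ₂ γ₁⁻¹ γ₂⁻¹ 1 Ω δ ((Ωp : Literature.NumberTheory.EllipticCurves.unrIntegers p) : PadicComplex p) LK → Literature.NumberTheory.EllipticCurves.IsGreenbergLFunctionAnyRoot₂ ι v vbar κ₁ κ₂ γ₁⁻¹ γ₂⁻¹ f (NumberField.discr K).natAbs (NumberField.classNumber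 K) LK G → Literature.NumberTheory.EllipticCurves.IsGreenbergLFunctionAnyRoot₂ ι v vbar κ₁ κ₂ γ₁⁻¹ γ₂⁻¹ f' (NumberField.discr K).natAbs (NumberField.classNumber K) LK G' → ∀ J : ℤ_[p] →+* PadicComplexInt p, (∀ x : ℤ_[p], ((J x : PadicComplexInt p) : PadicComplex p) = ((x : ℚ_[p]) : PadicComplex p)) → ∃ s : PowerSeries (PadicComplexInt p), s ≠ 0 ∧ Ideal.span {PowerSeries.map (PowerSeries.C (R := PadicComplexInt p)) s} * ((WeierstrassCurve.XGr₂.charIdeal (W.baseChange K) p κ₁ κ₂ vbar γ₁ γ₂).map (Literature.NumberTheory.EllipticCurves.IwasawaAlgebra₂.toUnr₂ p J) * (WeierstrassCurve.XGr₂.charIdeal (W'.baseChange K) p κ₁ κ₂ vbar γ₁ γ₂).map (Literature.NumberTheory.EllipticCurves.IwasawaAlgebra₂.toUnr₂ p J)) ≤ Ideal.span {G * G'}) → ∀ ε : ℤˣ, KobayashiLowerDivisibility W p ε) :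
    SignedDescentFromGreenbergFrames := by
  intro h41 h12 hF W _ _ p _ hp5 hX hs hpkg ε
  have hp2 : p ≠ 2 := by omega
  exact kobayashiMainConjecture_of_lowerDivisibility_of_periodUnit h12 h41 W p hp2 hX.1.1
    (ClassX7.frobeniusTrace_eq_zero_of_five_le W p hp5 hX) hs (hunit W p hp5 hX hs) ε
    (hdesc h12 hF W p hp5 hX hs hpkg ε)

open Summit.BirchSwinnertonDyer.BirchSwinnertonDyer.Theses.SignedBaseChange
  Summit.BirchSwinnertonDyer.Rank1Residual.Supersingular Kobayashi2003 in
/-- **K2R from the signed lower descent, granted the period-unit NAMED FACT** `realPeriodRat_eq_unit_mul_plusPeriod`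
(Greenberg–Vatsal 2000 §3 Rem. 3.4 / Abbes–Ullmo / Edixhoven; in the tree a `def … : Prop`, the conjunct
`RealPeriodUnitPlusPeriod` of the route's support item `PublishedSignedInputs`; NOT among K2R's own binders): at an X7
pair `E[p]` is irreducible (`ClassX7.irr`), so `padicValRat_periodRatio_eq_zero_of_five_le` supplies (U).
CONDITIONAL on the named fact and on (D). [cite: GreenbergVatsal2000, §3 Remark 3.4]
[cite: Kobayashi2003, Conjecture (p. 2), Thm. 1.2, Thm. 4.1 (p. 8)] -/
theorem signedDescentFromGreenbergFrames_of_periodFact_of_lowerDescent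
    (h5 : realPeriodRat_eq_unit_mul_plusPeriod)
    (hdesc : thm12_signedSelmerDual_finite_torsion → GreenbergFramesAtSupersingular →
      ∀ (W : WeierstrassCurve ℚ) [W.IsElliptic] [W.IsGloballyMinimal] (p : ℕ) [Fact p.Prime], 5 ≤ p →
      ClassX7 W p → Surj W p → (∃ (K : Type) (_ : Field K) (_ : NumberField K) (ι : PadicAlgCl p ≃+* ℂ) (v vbar : IsDedekindDomain.HeightOneSpectrum (NumberField.RingOfIntegers K)) (κ₁ κ₂ : Literature.NumberTheory.EllipticCurves.ZpExtension K p) (γ₁ γ₂ : Field.absoluteGaloisGroup K) (_ : Fact (Literature.NumberTheory.EllipticCurves.ZpExtension.IsTopGeneratorPair κ₁ κ₂ γ₁ γ₂)) (_ : NeZero (NumberField.discr K).natAbs) (N : ℕ) (_ : NeZero N) (f : CuspForm (CongruenceSubgroup.Gamma0 N) 2) (d : ℤ) (W' : WeierstrassCurve ℚ) (_ : W'.IsElliptic) (_ : W'.IsGloballyMinimal) (C : WeierstrassCurve.VariableChange ℚ) (N' : ℕ) (_ : NeZero N') (f' : CuspForm (CongruenceSubgroup.Gamma0 N') 2), Literature.NumberTheory.EllipticCurves.ModularForms.IsNewformOf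 W f ∧ (N : ℤ) = W.conductorNorm ℤ ∧ Literature.NumberTheory.EllipticCurves.ModularForms.IsNewformOf W' f' ∧ (N' : ℤ) = W'.conductorNorm ℤ ∧ Squarefree d ∧ 1 < d ∧ (∀ q : ℕ, q.Prime → Literature.NumberTheory.EllipticCurves.BurungaleSkinnerTianWan2024.RamifiedInQuadratic d q → q ≠ p ∧ ¬ q ∣ N ∧ ¬ (q : ℤ) ∣ NumberField.discr K) ∧ C • W' = W.quadraticTwist (d : ℚ) ∧ Literature.NumberTheory.EllipticCurves.IsImaginaryQuadratic K ∧ ((Ideal.span {(p : ℤ)}).primesOver (NumberField.RingOfIntegers K)).ncard = 2 ∧ ((p : ℕ) : NumberField.RingOfIntegers K) ∈ v.asIdeal ∧ ((p : ℕ) : NumberField.RingOfIntegers K) ∈ vbar.asIdeal ∧ vbar ≠ v ∧ (∀ (w : NumberField.InfinitePlace K) (k : NumberField.RingOfIntegers K), k ∈ v.asIdeal ↔ ‖ι.symm (w.embedding (k : K))‖ < 1) ∧ IsCoprime (N : ℤ) (NumberField.discr K) ∧ (∀ ρ : Literature.NumberTheory.GaloisRepresentations.ModPGaloisRep K (ZMod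 p) 2, (W.baseChange K).IsTorsionGaloisRep p ρ → Literature.NumberTheory.GaloisRepresentations.FramedRep.IsAbsolutelyIrreducible ρ) ∧ κ₁.IsCyclotomic ∧ κ₂.IsAnticyclotomic ∧ ∀ (Ω δ : ℂ) (Ωp : (Literature.NumberTheory.EllipticCurves.unrIntegers p)ˣ) (LK G G' : PowerSeries (PowerSeries (PadicComplexInt p))), Ω ≠ 0 → (δ ^ 2 = (NumberField.discr K : ℂ) ∨ δ ^ 2 = -(NumberField.discr K : ℂ)) → Literature.NumberTheory.EllipticCurves.IsKatzMeasure₂ ι v vbar ∅ κ₁ κ₂ γ₁⁻¹ γ₂⁻¹ 1 Ω δ ((Ωp : Literature.NumberTheory.EllipticCurves.unrIntegers p) : PadicComplex p) LK → Literature.NumberTheory.EllipticCurves.IsGreenbergLFunctionAnyRoot₂ ι v vbar κ₁ κ₂ γ₁⁻¹ γ₂⁻¹ f (NumberField.discr K).natAbs (NumberField.classNumber K) LK G → Literature.NumberTheory.EllipticCurves.IsGreenbergLFunctionAnyRoot₂ ι v vbar κ₁ κ₂ γ₁⁻¹ γ₂⁻¹ f' (NumberField.discr K).natAbs (NumberField.classNumber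 K) LK G' → ∀ J : ℤ_[p] →+* PadicComplexInt p, (∀ x : ℤ_[p], ((J x : PadicComplexInt p) : PadicComplex p) = ((x : ℚ_[p]) : PadicComplex p)) → ∃ s : PowerSeries (PadicComplexInt p), s ≠ 0 ∧ Ideal.span {PowerSeries.map (PowerSeries.C (R := PadicComplexInt p)) s} * ((WeierstrassCurve.XGr₂.charIdeal (W.baseChange K) p κ₁ κ₂ vbar γ₁ γ₂).map (Literature.NumberTheory.EllipticCurves.IwasawaAlgebra₂.toUnr₂ p J) * (WeierstrassCurve.XGr₂.charIdeal (W'.baseChange K) p κ₁ κ₂ vbar γ₁ γ₂).map (Literature.NumberTheory.EllipticCurves.IwasawaAlgebra₂.toUnr₂ p J)) ≤ Ideal.span {G * G'}) → ∀ ε : ℤˣ, KobayashiLowerDivisibility W p ε) :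
    SignedDescentFromGreenbergFrames :=
  signedDescentFromGreenbergFrames_of_periodUnit_of_lowerDescent
    (fun W _ _ p _ hp5 hX _ _ _ f hf ϖ hϖ ↦ padicValRat_periodRatio_eq_zero_of_five_le h5 W p hp5 hX.1.1
      (ClassX7.irr W p (by omega) hX) f hf ϖ hϖ)
    hdesc

/-! ## §7 (appended 2026-08-27, after the route's F-repair S1♮). K2R′ `SignedDescentFromCommonFrame` (item
stmt-BirchSwinnertonDyer-20417: K2R with the frame-supply antecedent F ↦ GSF `GreenbergSupersingularFrameInput`)
reduced to its Eisenstein half, exactly as §6 -/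

open Summit.BirchSwinnertonDyer.BirchSwinnertonDyer.Theses.SignedBaseChange
  Summit.BirchSwinnertonDyer.Rank1Residual.Supersingular Kobayashi2003 in
/-- **K2R′ reduced to its Eisenstein half.** `SignedDescentFromCommonFrame` follows from (U) the period-ratio unit at
every X7 pair with `p ≥ 5` and surjective `ρ̄` (in the tree the NAMED FACT `realPeriodRat_eq_unit_mul_plusPeriod`, not
a binder of K2R′) and (D′) the SIGNED LOWER DESCENT from GSF: Kobayashi Thm. 1.2, GSF and K1's twist-pair package imply
the EISENSTEIN HALF `KobayashiLowerDivisibility W p ε` for both signs (the registered stub `stub_signedLowerDescent` of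
the K2R′ skeleton, verbatim as the binder `hdesc`). Kato half = K2R′'s binder thm41; squeeze = §5. CONDITIONAL on (U)
and (D′); closes nothing by itself. [cite: Kobayashi2003, Conjecture (p. 2), Thm. 1.2, Thm. 4.1 (p. 8)] -/
theorem signedDescentFromCommonFrame_of_periodUnit_of_lowerDescent
    (hunit : ∀ (W : WeierstrassCurve ℚ) [W.IsElliptic] [W.IsGloballyMinimal] (p : ℕ) [Fact p.Prime],
      5 ≤ p → ClassX7 W p → Surj W p →
      ∀ {N : ℕ} [NeZero N] (f : CuspForm (Gamma0 N) 2), IsNewformOf W f →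
      ∀ ϖ : ℚ, (ϖ : ℝ) * W.realPeriodRat = plusPeriod f → padicValRat p ϖ = 0)
    (hdesc : thm12_signedSelmerDual_finite_torsion → GreenbergSupersingularFrameInput →
      ∀ (W : WeierstrassCurve ℚ) [W.IsElliptic] [W.IsGloballyMinimal] (p : ℕ) [Fact p.Prime], 5 ≤ p →
      ClassX7 W p → Surj W p → (∃ (K : Type) (_ : Field K) (_ : NumberField K) (ι : PadicAlgCl p ≃+* ℂ) (v vbar : IsDedekindDomain.HeightOneSpectrum (NumberField.RingOfIntegers K)) (κ₁ κ₂ : Literature.NumberTheory.EllipticCurves.ZpExtension K p) (γ₁ γ₂ : Field.absoluteGaloisGroup K) (_ : Fact (Literature.NumberTheory.EllipticCurves.ZpExtension.IsTopGeneratorPair κ₁ κ₂ γ₁ γ₂)) (_ : NeZero (NumberField.discr K).natAbs) (N : ℕ) (_ : NeZero N) (f : CuspForm (CongruenceSubgroup.Gamma0 N) 2) (d : ℤ) (W' : WeierstrassCurve ℚ) (_ : W'.IsElliptic) (_ : W'.IsGloballyMinimal) (C : WeierstrassCurve.VariableChange ℚ) (N' : ℕ) (_ : NeZero N') (f' : CuspForm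 (CongruenceSubgroup.Gamma0 N') 2), Literature.NumberTheory.EllipticCurves.ModularForms.IsNewformOf W f ∧ (N : ℤ) = W.conductorNorm ℤ ∧ Literature.NumberTheory.EllipticCurves.ModularForms.IsNewformOf W' f' ∧ (N' : ℤ) = W'.conductorNorm ℤ ∧ Squarefree d ∧ 1 < d ∧ (∀ q : ℕ, q.Prime → Literature.NumberTheory.EllipticCurves.BurungaleSkinnerTianWan2024.RamifiedInQuadratic d q → q ≠ p ∧ ¬ q ∣ N ∧ ¬ (q : ℤ) ∣ NumberField.discr K) ∧ C • W' = W.quadraticTwist (d : ℚ) ∧ Literature.NumberTheory.EllipticCurves.IsImaginaryQuadratic K ∧ ((Ideal.span {(p : ℤ)}).primesOver (NumberField.RingOfIntegers K)).ncard = 2 ∧ ((p : ℕ) : NumberField.RingOfIntegers K) ∈ v.asIdeal ∧ ((p : ℕ) : NumberField.RingOfIntegers K) ∈ vbar.asIdeal ∧ vbar ≠ v ∧ (∀ (w : NumberField.InfinitePlace K) (k : NumberField.RingOfIntegers K), k ∈ v.asIdeal ↔ ‖ι.symm (w.embedding (k : K))‖ < 1) ∧ IsCoprime (N : ℤ) (NumberField.discr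 K) ∧ (∀ ρ : Literature.NumberTheory.GaloisRepresentations.ModPGaloisRep K (ZMod p) 2, (W.baseChange K).IsTorsionGaloisRep p ρ → Literature.NumberTheory.GaloisRepresentations.FramedRep.IsAbsolutelyIrreducible ρ) ∧ κ₁.IsCyclotomic ∧ κ₂.IsAnticyclotomic ∧ ∀ (Ω δ : ℂ) (Ωp : (Literature.NumberTheory.EllipticCurves.unrIntegers p)ˣ) (LK G G' : PowerSeries (PowerSeries (PadicComplexInt p))), Ω ≠ 0 → (δ ^ 2 = (NumberField.discr K : ℂ) ∨ δ ^ 2 = -(NumberField.discr K : ℂ)) → Literature.NumberTheory.EllipticCurves.IsKatzMeasure₂ ι v vbar ∅ κ₁ κ₂ γ₁⁻¹ γ₂⁻¹ 1 Ω δ ((Ωp : Literature.NumberTheory.EllipticCurves.unrIntegers p) : PadicComplex p) LK → Literature.NumberTheory.EllipticCurves.IsGreenbergLFunctionAnyRoot₂ ι v vbar κ₁ κ₂ γ₁⁻¹ γ₂⁻¹ f (NumberField.discr K).natAbs (NumberField.classNumber K) LK G → Literature.NumberTheory.EllipticCurves.IsGreenbergLFunctionAnyRoot₂ ι v vbar κ₁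 κ₂ γ₁⁻¹ γ₂⁻¹ f' (NumberField.discr K).natAbs (NumberField.classNumber K) LK G' → ∀ J : ℤ_[p] →+* PadicComplexInt p, (∀ x : ℤ_[p], ((J x : PadicComplexInt p) : PadicComplex p) = ((x : ℚ_[p]) : PadicComplex p)) → ∃ s : PowerSeries (PadicComplexInt p), s ≠ 0 ∧ Ideal.span {PowerSeries.map (PowerSeries.C (R := PadicComplexInt p)) s} * ((WeierstrassCurve.XGr₂.charIdeal (W.baseChange K) p κ₁ κ₂ vbar γ₁ γ₂).map (Literature.NumberTheory.EllipticCurves.IwasawaAlgebra₂.toUnr₂ p J) * (WeierstrassCurve.XGr₂.charIdeal (W'.baseChange K) p κ₁ κ₂ vbar γ₁ γ₂).map (Literature.NumberTheory.EllipticCurves.IwasawaAlgebra₂.toUnr₂ p J)) ≤ Ideal.span {G * G'}) → ∀ ε : ℤˣ, KobayashiLowerDivisibility W p ε) :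
    SignedDescentFromCommonFrame := by
  intro h41 h12 hGF W _ _ p _ hp5 hX hs hpkg ε
  have hp2 : p ≠ 2 := by omega
  exact kobayashiMainConjecture_of_lowerDivisibility_of_periodUnit h12 h41 W p hp2 hX.1.1
    (ClassX7.frobeniusTrace_eq_zero_of_five_le W p hp5 hX) hs (hunit W p hp5 hX hs) ε
    (hdesc h12 hGF W p hp5 hX hs hpkg ε)

open Summit.BirchSwinnertonDyer.BirchSwinnertonDyer.Theses.SignedBaseChange
  Summit.BirchSwinnertonDyer.Rank1Residual.Supersingular Kobayashi2003 in
/-- **K2R′ from the signed lower descent, granted the period-unit NAMED FACT** `realPeriodRat_eq_unit_mul_plusPeriod`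
(conjunct `RealPeriodUnitPlusPeriod` of the route's `PublishedSignedInputs`; not a binder of K2R′): at an X7 pair
`E[p]` is irreducible (`ClassX7.irr`), so `padicValRat_periodRatio_eq_zero_of_five_le` supplies (U). CONDITIONAL on
the named fact and on (D′). [cite: GreenbergVatsal2000, §3 Remark 3.4] [cite: Kobayashi2003, Conjecture (p. 2), Thm. 1.2, Thm. 4.1 (p. 8)] -/
theorem signedDescentFromCommonFrame_of_periodFact_of_lowerDescent
    (h5 : realPeriodRat_eq_unit_mul_plusPeriod)
    (hdesc : thm12_signedSelmerDual_finite_torsion → GreenbergSupersingularFrameInput →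
      ∀ (W : WeierstrassCurve ℚ) [W.IsElliptic] [W.IsGloballyMinimal] (p : ℕ) [Fact p.Prime], 5 ≤ p →
      ClassX7 W p → Surj W p → (∃ (K : Type) (_ : Field K) (_ : NumberField K) (ι : PadicAlgCl p ≃+* ℂ) (v vbar : IsDedekindDomain.HeightOneSpectrum (NumberField.RingOfIntegers K)) (κ₁ κ₂ : Literature.NumberTheory.EllipticCurves.ZpExtension K p) (γ₁ γ₂ : Field.absoluteGaloisGroup K) (_ : Fact (Literature.NumberTheory.EllipticCurves.ZpExtension.IsTopGeneratorPair κ₁ κ₂ γ₁ γ₂)) (_ : NeZero (NumberField.discr K).natAbs) (N : ℕ) (_ : NeZero N) (f : CuspForm (CongruenceSubgroup.Gamma0 N) 2) (d : ℤ) (W' : WeierstrassCurve ℚ) (_ : W'.IsElliptic) (_ : W'.IsGloballyMinimal) (C : WeierstrassCurve.VariableChange ℚ) (N' : ℕ) (_ : NeZero N') (f' : CuspForm (CongruenceSubgroup.Gamma0 N') 2), Literature.NumberTheory.EllipticCurves.ModularForms.IsNewformOf W f ∧ (N : ℤ) = W.conductorNorm ℤ ∧ Literature.NumberTheory.EllipticCurves.ModularForms.IsNewformOf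 W' f' ∧ (N' : ℤ) = W'.conductorNorm ℤ ∧ Squarefree d ∧ 1 < d ∧ (∀ q : ℕ, q.Prime → Literature.NumberTheory.EllipticCurves.BurungaleSkinnerTianWan2024.RamifiedInQuadratic d q → q ≠ p ∧ ¬ q ∣ N ∧ ¬ (q : ℤ) ∣ NumberField.discr K) ∧ C • W' = W.quadraticTwist (d : ℚ) ∧ Literature.NumberTheory.EllipticCurves.IsImaginaryQuadratic K ∧ ((Ideal.span {(p : ℤ)}).primesOver (NumberField.RingOfIntegers K)).ncard = 2 ∧ ((p : ℕ) : NumberField.RingOfIntegers K) ∈ v.asIdeal ∧ ((p : ℕ) : NumberField.RingOfIntegers K) ∈ vbar.asIdeal ∧ vbar ≠ v ∧ (∀ (w : NumberField.InfinitePlace K) (k : NumberField.RingOfIntegers K), k ∈ v.asIdeal ↔ ‖ι.symm (w.embedding (k : K))‖ < 1) ∧ IsCoprime (N : ℤ) (NumberField.discr K) ∧ (∀ ρ : Literature.NumberTheory.GaloisRepresentations.ModPGaloisRep K (ZMod p) 2, (W.baseChange K).IsTorsionGaloisRep p ρ → Literature.NumberTheory.GaloisRepresentations.FramedRep.IsAbsolutelyIrreducible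 ρ) ∧ κ₁.IsCyclotomic ∧ κ₂.IsAnticyclotomic ∧ ∀ (Ω δ : ℂ) (Ωp : (Literature.NumberTheory.EllipticCurves.unrIntegers p)ˣ) (LK G G' : PowerSeries (PowerSeries (PadicComplexInt p))), Ω ≠ 0 → (δ ^ 2 = (NumberField.discr K : ℂ) ∨ δ ^ 2 = -(NumberField.discr K : ℂ)) → Literature.NumberTheory.EllipticCurves.IsKatzMeasure₂ ι v vbar ∅ κ₁ κ₂ γ₁⁻¹ γ₂⁻¹ 1 Ω δ ((Ωp : Literature.NumberTheory.EllipticCurves.unrIntegers p) : PadicComplex p) LK → Literature.NumberTheory.EllipticCurves.IsGreenbergLFunctionAnyRoot₂ ι v vbar κ₁ κ₂ γ₁⁻¹ γ₂⁻¹ f (NumberField.discr K).natAbs (NumberField.classNumber K) LK G → Literature.NumberTheory.EllipticCurves.IsGreenbergLFunctionAnyRoot₂ ι v vbar κ₁ κ₂ γ₁⁻¹ γ₂⁻¹ f' (NumberField.discr K).natAbs (NumberField.classNumber K) LK G' → ∀ J : ℤ_[p] →+* PadicComplexInt p, (∀ x : ℤ_[p], ((J x : PadicComplexInt p) : PadicComplex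 p) = ((x : ℚ_[p]) : PadicComplex p)) → ∃ s : PowerSeries (PadicComplexInt p), s ≠ 0 ∧ Ideal.span {PowerSeries.map (PowerSeries.C (R := PadicComplexInt p)) s} * ((WeierstrassCurve.XGr₂.charIdeal (W.baseChange K) p κ₁ κ₂ vbar γ₁ γ₂).map (Literature.NumberTheory.EllipticCurves.IwasawaAlgebra₂.toUnr₂ p J) * (WeierstrassCurve.XGr₂.charIdeal (W'.baseChange K) p κ₁ κ₂ vbar γ₁ γ₂).map (Literature.NumberTheory.EllipticCurves.IwasawaAlgebra₂.toUnr₂ p J)) ≤ Ideal.span {G * G'}) → ∀ ε : ℤˣ, KobayashiLowerDivisibility W p ε) :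
    SignedDescentFromCommonFrame :=
  signedDescentFromCommonFrame_of_periodUnit_of_lowerDescent
    (fun W _ _ p _ hp5 hX _ _ _ f hf ϖ hϖ ↦ padicValRat_periodRatio_eq_zero_of_five_le h5 W p hp5 hX.1.1
      (ClassX7.irr W p (by omega) hX) f hf ϖ hϖ)
    hdesc

/-! ## §8 (appended 2026-08-27). The PRODUCT SQUEEZE — the last, purely algebraic step (D4 of the census) of the signed
lower descent: the descent delivers ONE divisibility for the PRODUCT of the signed characteristic elements of the four
ℚ-curves `E, E^K, E^{(d)}, E^{(dK)}` (cyclotomic specialisation of the two two-variable signed objects of the twist pair),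
Kobayashi Thm. 4.1 gives the four OPPOSITE divisibilities one curve at a time, and in a domain these force all four
to be equalities. -/

/-- **Product squeeze.** In a commutative domain: if `g_i ∣ L_i` for every `i ∈ s` (the Kato–Kobayashi upper bounds),
`∏ L_i ∣ ∏ g_i` (the Eisenstein-side divisibility for the product) and every `L_i ≠ 0` (Pollack's `L_p^±` are non-zero),
then `g_i` and `L_i` are associated for every `i ∈ s` — so each `Char X^ε(E_i) = (g_i) = (L_i)`. [folklore] -/
theorem associated_of_dvd_of_prod_dvd_prod {R : Type*} [CommRing R] [IsDomain R] {ι : Type*} (s : Finset ι)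
    (g L : ι → R) (hL : ∀ i ∈ s, L i ≠ 0) (hdvd : ∀ i ∈ s, g i ∣ L i)
    (hprod : ∏ i ∈ s, L i ∣ ∏ i ∈ s, g i) : ∀ i ∈ s, Associated (g i) (L i) := by
  classical
  choose! k hk using hdvd
  have hL' : ∏ i ∈ s, L i = (∏ i ∈ s, g i) * ∏ i ∈ s, k i := by
    rw [← Finset.prod_mul_distrib]
    exact Finset.prod_congr rfl hk
  obtain ⟨h, hh⟩ := hprod
  have hg0 : ∏ i ∈ s, g i ≠ 0 :=
    Finset.prod_ne_zero_iff.mpr fun i hi h0 ↦ hL i hi (by rw [hk i hi, h0, zero_mul])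
  have h1 : (∏ i ∈ s, k i) * h = 1 :=
    mul_left_cancel₀ hg0 (by rw [← mul_assoc, ← hL', ← hh, mul_one])
  have hunit : IsUnit (∏ i ∈ s, k i) := IsUnit.of_mul_eq_one h h1
  intro i hi
  have hki : IsUnit (k i) := isUnit_of_dvd_unit (Finset.dvd_prod_of_mem k hi) hunit
  exact ⟨hki.unit, by rw [IsUnit.unit_spec, hk i hi]⟩

/-- The product squeeze read on principal ideals: `(g_i) = (L_i)` for every `i ∈ s`. [folklore] -/
theorem span_singleton_eq_of_dvd_of_prod_dvd_prod {R : Type*} [CommRing R] [IsDomain R] {ι : Type*}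
    (s : Finset ι) (g L : ι → R) (hL : ∀ i ∈ s, L i ≠ 0) (hdvd : ∀ i ∈ s, g i ∣ L i)
    (hprod : ∏ i ∈ s, L i ∣ ∏ i ∈ s, g i) {i : ι} (hi : i ∈ s) :
    Ideal.span {g i} = Ideal.span {L i} :=
  Ideal.span_singleton_eq_span_singleton.mpr (associated_of_dvd_of_prod_dvd_prod s g L hL hdvd hprod i hi)

end Summit.BirchSwinnertonDyer.BirchSwinnertonDyer.Theorems.SignedBaseChangeK2RSqueeze

end
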